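import Mathlib.NumberTheory.ModularForms.CongruenceSubgroups
import Literature.AnabelianGeometry.AbsoluteAnabelian.ArchimedeanHolFieldFunctorGeometricPSL
import HarnessLib

/-!
# The explicit cusped base `Γ̄(2) ≤ PSL₂(ℝ)`, part 1a: no elliptic traces; hypothesis (P)

abc-iut cell, LINEAGE ROW «J2i-GAMMA2-MODEL» (GO abc-iut-L4-lead m61), seat abc-iut-L4-d1: an EXPLICIT
arithmetic uniformising group at which the geometric [AbsTopIII] Prop 4.2 (i) column (S. Mochizuki,
*Topics in Absolute Anabelian Geometry III*, proof of Prop. 4.2 (i) p. 106) can fire with zero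
hypotheses — `Γ̄(2) := π(Γ(2))`, the image in `PSL₂(ℝ)` of the principal congruence subgroup of level
`2` (Mathlib `CongruenceSubgroup.Gamma 2`), written out in full (no definition):
`((CongruenceSubgroup.Gamma 2).map (Matrix.SpecialLinearGroup.map (Int.castRingHom ℝ))).map π`.
This first PROOF-ONLY file (no definitions, no named facts) gives

* `trace_ne_zero_of_mem_Gamma_two` — for `γ ∈ Γ(2)`, `a + d ≠ 0` (parity: `a ≡ d ≡ 1`, `b ≡ c ≡ 0 (2)`
  and `a + d = 0` force `a² ≡ 3 (4)`): the arithmetic heart of "Γ(2) has no elliptic elements";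
* `exists_parabolic_mem_pslGamma_two` — hypothesis (P) of abc-iut-L4-d1's
  `finiteIndex_subgroupOf_normalizer_of_cusps` for `Γ̄(2)`: the lift `T² = [[1, 2], [0, 1]]` is parabolic.

HONEST SCOPE: `ℍ/Γ̄(2)` is a genuine cusped hyperbolic Riemann surface, but its identification with the
printed tripod `ℙ¹ ∖ {0, 1, ∞}` (the modular `λ`-function) is NOT claimed anywhere in this row.
Classical (Farkas–Kra IV.5–6; Shimura §1.6); nothing here bears on [IUTchIII] Cor. 3.12.
-/

noncomputable section

open scoped MatrixGroups

namespace Literature.AnabelianGeometry.AbsoluteAnabelian.HolRS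

/-- **No elliptic traces in `Γ(2)`**: for `γ ∈ Γ(2)` the trace `a + d` is non-zero (it is even, and
`a + d = 0` would give `a² + bc = -1` with `4 ∣ bc`, i.e. `a² ≡ 3 (mod 4)`).  Hence every `γ ≠ ±1` in
`Γ(2)` has `|a + d| ≥ 2`: parabolic or hyperbolic, never elliptic. [cite: FarkasKra1992, IV.5.6] -/
theorem trace_ne_zero_of_mem_Gamma_two {γ : SL(2, ℤ)} (hγ : γ ∈ CongruenceSubgroup.Gamma 2) :
    (γ : Matrix (Fin 2) (Fin 2) ℤ) 0 0 + (γ : Matrix (Fin 2) (Fin 2) ℤ) 1 1 ≠ 0 := by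
  rw [CongruenceSubgroup.Gamma_mem] at hγ
  obtain ⟨h00, h01, h10, -⟩ := hγ
  have hdet := Matrix.SpecialLinearGroup.det_coe γ
  rw [Matrix.det_fin_two] at hdet
  have p00 : (2 : ℤ) ∣ (γ : Matrix (Fin 2) (Fin 2) ℤ) 0 0 - 1 := by
    have : (((γ : Matrix (Fin 2) (Fin 2) ℤ) 0 0 - 1 : ℤ) : ZMod 2) = 0 := by push_cast; rw [h00, sub_self]
    exact (ZMod.intCast_zmod_eq_zero_iff_dvd _ 2).mp this
  have p01 : (2 : ℤ) ∣ (γ : Matrix (Fin 2) (Fin 2) ℤ) 0 1 := (ZMod.intCast_zmod_eq_zero_iff_dvd _ 2).mp h01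
  have p10 : (2 : ℤ) ∣ (γ : Matrix (Fin 2) (Fin 2) ℤ) 1 0 := (ZMod.intCast_zmod_eq_zero_iff_dvd _ 2).mp h10
  obtain ⟨k, hk⟩ := p00
  obtain ⟨m, hm⟩ := p01
  obtain ⟨n, hn⟩ := p10
  intro htr
  have hd : (γ : Matrix (Fin 2) (Fin 2) ℤ) 1 1 = -(γ : Matrix (Fin 2) (Fin 2) ℤ) 0 0 := by linarith
  have ha : (γ : Matrix (Fin 2) (Fin 2) ℤ) 0 0 = 2 * k + 1 := by linarith
  rw [hd, ha, hm, hn] at hdet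
  have h4 : 4 * (k * k + k + m * n) = -2 := by linear_combination -hdet
  omega

/-- **Hypothesis (P) for `Γ̄(2)`**: the lift `T² = [[1, 2], [0, 1]] ∈ Γ(2)` of an element of
`Γ̄(2) = π(Γ(2)) ≤ PSL₂(ℝ)` is parabolic — in the exact binder shape of
`finiteIndex_subgroupOf_normalizer_of_cusps`. [cite: FarkasKra1992, IV.5.6]
[cite: MochizukiAbsTopIII2015, Proposition 4.2 (i) proof p.106] -/
theorem exists_parabolic_mem_pslGamma_two :
    ∃ t : SL(2, ℝ), QuotientGroup.mk' (Subgroup.center SL(2, ℝ)) t ∈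
      ((CongruenceSubgroup.Gamma 2).map (Matrix.SpecialLinearGroup.map (Int.castRingHom ℝ))).map
        (QuotientGroup.mk' (Subgroup.center SL(2, ℝ))) ∧
      (t : Matrix (Fin 2) (Fin 2) ℝ).IsParabolic := by
  let T2 : SL(2, ℤ) := ⟨!![1, 2; 0, 1], by simp [Matrix.det_fin_two_of]⟩
  have hT2 : T2 ∈ CongruenceSubgroup.Gamma 2 := by
    rw [CongruenceSubgroup.Gamma_mem]
    refine ⟨?_, ?_, ?_, ?_⟩ <;> simp [T2]
    decide
  refine ⟨Matrix.SpecialLinearGroup.map (Int.castRingHom ℝ) T2,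
    Subgroup.mem_map_of_mem _ (Subgroup.mem_map_of_mem _ hT2), ?_⟩
  have h10 : ((Matrix.SpecialLinearGroup.map (Int.castRingHom ℝ) T2 : SL(2, ℝ)) :
      Matrix (Fin 2) (Fin 2) ℝ) 1 0 = 0 := by
    simp [T2]
  refine (Matrix.isParabolic_iff_of_upperTriangular h10).mpr ⟨?_, ?_⟩ <;> simp [T2]

end Literature.AnabelianGeometry.AbsoluteAnabelian.HolRS

end
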